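import Literature.MathematicalPhysics.QuantumFieldTheory.Chatterjee2019LargeN.AreaLowerBound
import HarnessLib

/-!
# Chatterjee 2019, Corollary 3.5 (first display) from Theorem 3.1: real analyticity at strong coupling

S. Chatterjee, *Rigorous solution of strongly coupled `SO(N)` lattice gauge theory in the large `N` limit*,
Comm. Math. Phys. **366** (2019) 203–268 (arXiv:1502.07719), **Corollary 3.5** («Another simple corollary of
Theorem 3.1 shows that the limits of Wilson loop expectations have power series expansions in `β` when `|β|` is
small»; §16: «Corollary 3.5 can be derived purely from the statement of Theorem 3.1»).

THEOREMS ONLY (net debt 0; v1.1 adds `logPartitionPowerSeries_of_limitingPartitionFunction : LimitingPartitionFunction d →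
LogPartitionPowerSeries d`, Corollary 3.5's second display from Corollary 3.4 by the same regrouping):
`realAnalyticity_of_gaugeStringDuality : GaugeStringDuality d →
RealAnalyticityStrongCoupling d` — the tree's named fact for Corollary 3.5 (first display) follows from the tree's
named fact for Theorem 3.1 by regrouping the absolutely convergent sum `Σ_{X ∈ 𝒳(s)} w_β(X)` according to the number
of deformations `δ(X) = k`: `w_β(X) = v(X) β^{δ(X)}` (`Trajectory.weight_eq_vweight_mul_pow`), each `𝒳ₖ(s)` is finite
(`finite_trajectoryWith`) and `a_k(s) = Σ_{X ∈ 𝒳ₖ(s)} v(X)` (`coeffA`), so `Σ_X w_β(X) = Σ_k a_k(s) β^k`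
(`HasSum.tsum_fiberwise`).

Consequence recorded: Corollary 3.3 in the loopwise form of `AreaLowerBound` follows from Theorem 3.1 alone
(`areaLawUpperBound_loopwise_of_gaugeStringDuality`).

## WHAT THIS IS NOT
Theorem 3.1 (`GaugeStringDuality`) remains a named fact; the second display of Corollary 3.5
(`LogPartitionPowerSeries`) is not treated here.
-/

noncomputable section

open Filter Topology
open Literature.Probability.LatticeModels Literature.MathematicalPhysics.QuantumLattice

namespace Literature.MathematicalPhysics.QuantumFieldTheory.Chatterjee2019LargeN

variable {d : ℕ}

/-- Regrouping by the number of deformations: if `X ↦ w_β(X)` is summable over `𝒳(s)` then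
`Σ_k a_k(s) β^k = Σ_{X ∈ 𝒳(s)} w_β(X)` (as a `HasSum`). [cite: Chatterjee2019LargeN, Corollary 3.5 (a_k(s) = Σ_{X ∈ 𝒳ₖ(s)} v(X)), §3 (w_β(X) = v(X) β^{δ(X)})] -/
theorem hasSum_coeffA_mul_pow {s : LoopSeq d} {β : ℝ} (h : Summable fun X : Trajectory s => X.weight β) :
    HasSum (fun k : ℕ => coeffA s k * β ^ k) (∑' X : Trajectory s, X.weight β) := by
  have h1 := h.hasSum.tsum_fiberwise fun X : Trajectory s => X.numDeform
  have h2 : (fun k : ℕ => ∑' X : ↥((fun X : Trajectory s => X.numDeform) ⁻¹' {k}), (X : Trajectory s).weight β) =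
      fun k : ℕ => coeffA s k * β ^ k := by
    funext k
    change ∑' X : TrajectoryWith s k, X.1.weight β = _
    rw [coeffA, ← tsum_mul_right]
    refine tsum_congr fun X => ?_
    rw [Trajectory.weight_eq_vweight_mul_pow, X.2]
  rwa [h2] at h1

/-- **Corollary 3.5 (first display) from Theorem 3.1, PROVED**: under gauge–string duality, for `|β| ≤ β₀(d)` and every
genuine loop sequence `s`, `k ↦ a_k(s) β^k` is summable and `φ_{Λ_N,N,β}(s) → Σ_k a_k(s) β^k`.
[cite: Chatterjee2019LargeN, Corollary 3.5 (first display) and §16 («can be derived purely from the statement of Theorem 3.1»)] -/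
theorem realAnalyticity_of_gaugeStringDuality (h : GaugeStringDuality d) : RealAnalyticityStrongCoupling d := by
  intro hd
  obtain ⟨β₀, hβ₀, H⟩ := h hd
  refine ⟨β₀, hβ₀, fun Λ hΛ β hβ s hs _ => ?_⟩
  obtain ⟨hsum, hlim⟩ := H Λ hΛ β hβ s hs
  have hfib := hasSum_coeffA_mul_pow hsum
  refine ⟨hfib.summable, ?_⟩
  rwa [← hfib.tsum_eq] at hlim

/-- **Corollary 3.3 (loopwise form) from Theorem 3.1 alone** («It is easy to give an argument that is purely derived
from the statement of Theorem 3.1», §14): combine `realAnalyticity_of_gaugeStringDuality` with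
`areaLawUpperBound_loopwise` (sibling module `AreaLowerBound`: Lemma 14.1 and the §14 argument).
[cite: Chatterjee2019LargeN, Corollary 3.3 and §14 (first sentence after Lemma 14.1's proof)] -/
theorem areaLawUpperBound_loopwise_of_gaugeStringDuality (h : GaugeStringDuality d) (hd : 2 ≤ d) :
    ∃ β₀ : ℝ, 0 < β₀ ∧
      ∀ Λ : ℕ → Finset (Literature.Probability.LatticeModels.Site d), IsExhaustion Λ →
        ∀ l : Word d, IsLoop l → l ≠ [] →
          ∃ M : ℝ, 0 ≤ M ∧ ∀ β : ℝ, |β| ≤ β₀ →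
            ∃ L : ℝ,
              Tendsto (fun N : ℕ => |soExpect N β (Λ N) (wilsonLoopVar N l)| / N) atTop (𝓝 L) ∧
                L ≤ M * (|β| / β₀) ^ area l :=
  areaLawUpperBound_loopwise (realAnalyticity_of_gaugeStringDuality h) hd

/-! ### Corollary 3.5, second display (v1.1): the log-partition power series from Corollary 3.4 -/

/-- Regrouping by the number of deformations, with the weights `1/(δ(X)+1)` of Corollary 3.4: if
`X ↦ w_β(X)/(δ(X)+1)` is summable over `𝒳((p))` then `Σ_k a_k β^k/(k+1) = Σ_X w_β(X)/(δ(X)+1)` (as a `HasSum`).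
[cite: Chatterjee2019LargeN, Corollary 3.5 (second display: «a similar representation»), Corollary 3.4] -/
theorem hasSum_coeffA_mul_pow_div {s : LoopSeq d} {β : ℝ}
    (h : Summable fun X : Trajectory s => X.weight β / (X.numDeform + 1)) :
    HasSum (fun k : ℕ => coeffA s k * β ^ k / (k + 1)) (∑' X : Trajectory s, X.weight β / (X.numDeform + 1)) := by
  have h1 := h.hasSum.tsum_fiberwise fun X : Trajectory s => X.numDeform
  have h2 : (fun k : ℕ => ∑' X : ↥((fun X : Trajectory s => X.numDeform) ⁻¹' {k}),
      (X : Trajectory s).weight β / ((X : Trajectory s).numDeform + 1)) = fun k : ℕ => coeffA s k * β ^ k / (k + 1) := by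
    funext k
    change ∑' X : TrajectoryWith s k, X.1.weight β / (X.1.numDeform + 1) = _
    rw [coeffA, ← tsum_mul_right, ← tsum_div_const]
    refine tsum_congr fun X => ?_
    rw [Trajectory.weight_eq_vweight_mul_pow, X.2]
  rwa [h2] at h1

/-- ★ **Corollary 3.5, second display ⇐ Corollary 3.4, PROVED**: «The rescaled log-partition function has a similar
representation: `lim log Z_{Λ_N,N,β}/(N²|Λ_N|) = (d(d−1)/2) Σ_{k≥0} a_k(s) β^{k+1}/(k+1)`, where, again, the series is
absolutely convergent» — from Corollary 3.4 (`LimitingPartitionFunction`: the limit is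
`(β d(d−1)/2) Σ_{X∈𝒳(p)} w_β(X)/(δ(X)+1)`, that series summable) by regrouping the trajectory sum by the number of
deformations (`hasSum_coeffA_mul_pow_div`).  `LimitingPartitionFunction` (Corollary 3.4, §15) remains a named fact.
[cite: Chatterjee2019LargeN, Corollary 3.5 (second display), Corollary 3.4] -/
theorem logPartitionPowerSeries_of_limitingPartitionFunction (h : LimitingPartitionFunction d) :
    LogPartitionPowerSeries d := by
  intro hd
  obtain ⟨β₀, hβ₀, H⟩ := h hd
  refine ⟨β₀, hβ₀, fun M hM hMt β hβ p => ?_⟩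
  obtain ⟨hsum, hlim⟩ := H M hM hMt β hβ p
  have hfib := hasSum_coeffA_mul_pow_div hsum
  have hser : HasSum (fun k : ℕ => coeffA [plaquetteWord p] k * β ^ (k + 1) / (k + 1))
      (β * ∑' X : Trajectory [plaquetteWord p], X.weight β / (X.numDeform + 1)) := by
    have h2 := hfib.mul_left β
    refine h2.congr_fun fun k => ?_
    rw [pow_succ]
    ring
  refine ⟨hser.summable, ?_⟩
  rw [hser.tsum_eq]
  have he : (d : ℝ) * ((d : ℝ) - 1) / 2 * (β * ∑' X : Trajectory [plaquetteWord p], X.weight β / (X.numDeform + 1))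
      = β * d * ((d : ℝ) - 1) / 2 * ∑' X : Trajectory [plaquetteWord p], X.weight β / (X.numDeform + 1) := by ring
  rw [he]
  exact hlim

end Literature.MathematicalPhysics.QuantumFieldTheory.Chatterjee2019LargeN

end
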